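import Literature.Analysis.SpecialFunctions.TricomiIntegral

/-!
# Whittaker's function `W_{κ,μ}(z)` via Tricomi's `U` and Whittaker's equation on `Re z > 0`

For `Re(½ + μ − κ) > 0` and `Re z > 0` we define

  `W_{κ,μ}(z) = e^{−z/2} z^{½+μ} U(½ + μ − κ, 1 + 2μ, z)`                          (DLMF 13.14.3)

with `U` the Tricomi function of `TricomiIntegral.lean` (integral representation DLMF 13.4.4, so
`U` — hence `W` — is only claimed to be DLMF's function in that range), and prove
**Whittaker's equation** (DLMF 13.14.1)

  `W″ + (−¼ + κ/z + (¼ − μ²)/z²) W = 0`     on `Re z > 0`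

from Kummer's equation for `U` (`tricomiU_kummer`) by the product rule: with `φ = e^{−z/2} z^{s}`,
`s = μ + ½ = b/2`, `φ′ = φ(−½ + s/z)`, the `w′`-terms of `(φ w)″` cancel exactly when `2s = b`,
and the `w`-terms give the Whittaker coefficient (`s − a = κ`, `s − s² = ¼ − μ²`). Contents:

* `whittakerW`; `hasDerivAt_exp_mul_cpow` (the factor `φ`);
* `hasDerivAt_whittakerFn`, `whittakerFn_ode` — the general statement for
  `z ↦ e^{−z/2} z^{s} U(a,b,z)` with `b = 2s`;
* `hasDerivAt_whittakerW`, `deriv_whittakerW`, `differentiableOn_whittakerW`,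
  `analyticOnNhd_whittakerW`, and `whittakerW_ode` (DLMF 13.14.1 with Mathlib's `deriv`);
* `whittaker_params_T1w_admissible` — the parameters `κ = im`, `μ = ±iδ` (`m, δ` real) of the
  far face of the extremal Kerr threshold problem
  (`Literature/Geometry/Lorentzian/ExtremalKerrThresholdCoulomb.lean`) satisfy
  `Re(½ + μ − κ) = ½ > 0`, so `W_{im,±iδ}` is available on `Re z > 0`.

NOT here: the second solution `M_{κ,μ}` (series side, another file), the connection formula
13.14.33, the large-`|z|` asymptotics 13.14.21, and the continuation to the ray `z = −2iρ`
(`|ph z| = π/2`, outside the half-plane of this file) that the Coulomb problem ultimately needs.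

References: NIST DLMF 13.14.1, 13.14.3 [DLMF].
-/

noncomputable section

open Filter Metric Set
open scoped Topology

namespace Literature.Analysis.SpecialFunctions.Confluent

/-- **Whittaker's function** `W_{κ,μ}(z) = e^{−z/2} z^{½+μ} U(½ + μ − κ, 1 + 2μ, z)` (principal
power), valid for `Re(½ + μ − κ) > 0`, `Re z > 0` (junk elsewhere, as `tricomiU`).
[cite: DLMF, 13.14.3] -/
def whittakerW (κ μ z : ℂ) : ℂ :=
  Complex.exp (-z / 2) * z ^ (μ + 1 / 2) * tricomiU (1 / 2 + μ - κ) (1 + 2 * μ) z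

/-- A point of the open right half-plane is non-zero and lies in the slit plane. [folklore] -/
theorem mem_slitPlane_of_re_pos {z : ℂ} (hz : 0 < z.re) : z ∈ Complex.slitPlane ∧ z ≠ 0 :=
  ⟨Complex.mem_slitPlane_iff.2 (Or.inl hz),
    Complex.slitPlane_ne_zero (Complex.mem_slitPlane_iff.2 (Or.inl hz))⟩

/-- The prefactor `φ(z) = e^{−z/2} z^{s}` has `φ′ = φ · (−½ + s/z)` on the slit plane. [folklore] -/
theorem hasDerivAt_exp_mul_cpow (s : ℂ) {z : ℂ} (hz : z ∈ Complex.slitPlane) :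
    HasDerivAt (fun y : ℂ => Complex.exp (-y / 2) * y ^ s)
      (Complex.exp (-z / 2) * z ^ s * (-1 / 2 + s / z)) z := by
  have hz0 : z ≠ 0 := Complex.slitPlane_ne_zero hz
  have h1 : HasDerivAt (fun y : ℂ => Complex.exp (-y / 2)) (Complex.exp (-z / 2) * (-1 / 2)) z :=
    ((hasDerivAt_id' z).neg.div_const 2).cexp
  have h2 : HasDerivAt (fun y : ℂ => y ^ s) (s * z ^ (s - 1) * 1) z :=
    (hasDerivAt_id' z).cpow_const hz
  refine (h1.fun_mul h2).congr_deriv ?_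
  rw [Complex.cpow_sub _ _ hz0, Complex.cpow_one]
  field_simp

/-- **First derivative of `e^{−z/2} z^{s} U(a,b,z)`** on `Re z > 0` (`Re a > 0`):
`(φ U)′ = φ · ((−½ + s/z) U(a,b,z) − a U(a+1,b+1,z))` (product rule with DLMF 13.3.22).
[cite: DLMF, 13.3.22] -/
theorem hasDerivAt_whittakerFn {a : ℂ} (b s : ℂ) (ha : 0 < a.re) {z : ℂ} (hz : 0 < z.re) :
    HasDerivAt (fun y : ℂ => Complex.exp (-y / 2) * y ^ s * tricomiU a b y)
      (Complex.exp (-z / 2) * z ^ s *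
        ((-1 / 2 + s / z) * tricomiU a b z + -a * tricomiU (a + 1) (b + 1) z)) z := by
  have h := (hasDerivAt_exp_mul_cpow s (mem_slitPlane_of_re_pos hz).1).fun_mul
    (hasDerivAt_tricomiU b ha hz)
  refine h.congr_deriv ?_
  ring

/-- **Second derivative step**: the derivative at `z` of
`y ↦ φ(y)((−½ + s/y) U(a,b,y) − a U(a+1,b+1,y))` on `Re z > 0` (`Re a > 0`), with
`U(a+1,b+1)′ = −(a+1) U(a+2,b+2)`. [cite: DLMF, 13.3.22] -/
theorem hasDerivAt_whittakerFn_deriv {a : ℂ} (b s : ℂ) (ha : 0 < a.re) {z : ℂ} (hz : 0 < z.re) :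
    HasDerivAt (fun y : ℂ => Complex.exp (-y / 2) * y ^ s *
        ((-1 / 2 + s / y) * tricomiU a b y + -a * tricomiU (a + 1) (b + 1) y))
      (Complex.exp (-z / 2) * z ^ s *
        ((-1 / 2 + s / z) * ((-1 / 2 + s / z) * tricomiU a b z + -a * tricomiU (a + 1) (b + 1) z) +
          ((0 * z - s * 1) / z ^ 2 * tricomiU a b z +
              (-1 / 2 + s / z) * (-a * tricomiU (a + 1) (b + 1) z) +
            -a * (-(a + 1) * tricomiU (a + 2) (b + 2) z)))) z := by
  obtain ⟨hzs, hz0⟩ := mem_slitPlane_of_re_pos hz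
  have ha1 : 0 < (a + 1).re := by simp; linarith
  have hq : HasDerivAt (fun y : ℂ => -1 / 2 + s / y) ((0 * z - s * 1) / z ^ 2) z :=
    ((hasDerivAt_const z s).fun_div (hasDerivAt_id' z) hz0).const_add (-1 / 2)
  have hU1 : HasDerivAt (fun y : ℂ => -a * tricomiU (a + 1) (b + 1) y)
      (-a * (-(a + 1) * tricomiU (a + 2) (b + 2) z)) z := by
    have h := (hasDerivAt_tricomiU (b + 1) ha1 hz).const_mul (-a)
    rw [show a + 1 + 1 = a + 2 by ring, show b + 1 + 1 = b + 2 by ring] at h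
    exact h
  have hg := (hq.fun_mul (hasDerivAt_tricomiU b ha hz)).fun_add hU1
  exact ((hasDerivAt_exp_mul_cpow s hzs).fun_mul hg).congr_deriv (by ring)

/-- **Whittaker's equation for `e^{−z/2} z^{s} U(a,b,z)` with `b = 2s`** on `Re z > 0`
(`Re a > 0`): `f″ + (−¼ + (s − a)/z + (s − s²)/z²) f = 0`, from Kummer's equation
`z U″ + (b − z) U′ − a U = 0` (`tricomiU_kummer`): the residual equals `(φ/z)·(Kummer)`.
[cite: DLMF, 13.14.1] -/
theorem whittakerFn_ode {a b s : ℂ} (hb : b = 2 * s) (ha : 0 < a.re) {z : ℂ} (hz : 0 < z.re) :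
    deriv (deriv (fun y : ℂ => Complex.exp (-y / 2) * y ^ s * tricomiU a b y)) z +
      (-1 / 4 + (s - a) / z + (s - s ^ 2) / z ^ 2) *
        (Complex.exp (-z / 2) * z ^ s * tricomiU a b z) = 0 := by
  obtain ⟨-, hz0⟩ := mem_slitPlane_of_re_pos hz
  have hopen : IsOpen {w : ℂ | 0 < w.re} := isOpen_lt continuous_const Complex.continuous_re
  have h1 : deriv (fun y : ℂ => Complex.exp (-y / 2) * y ^ s * tricomiU a b y) =ᶠ[𝓝 z]
      fun y : ℂ => Complex.exp (-y / 2) * y ^ s *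
        ((-1 / 2 + s / y) * tricomiU a b y + -a * tricomiU (a + 1) (b + 1) y) :=
    Filter.eventually_of_mem (hopen.mem_nhds hz) fun w hw =>
      (hasDerivAt_whittakerFn b s ha hw).deriv
  rw [h1.deriv_eq, (hasDerivAt_whittakerFn_deriv b s ha hz).deriv]
  have hK := tricomiU_kummer b ha hz
  subst hb
  have key : Complex.exp (-z / 2) * z ^ s *
        ((-1 / 2 + s / z) * ((-1 / 2 + s / z) * tricomiU a (2 * s) z +
            -a * tricomiU (a + 1) (2 * s + 1) z) +
          ((0 * z - s * 1) / z ^ 2 * tricomiU a (2 * s) z +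
              (-1 / 2 + s / z) * (-a * tricomiU (a + 1) (2 * s + 1) z) +
            -a * (-(a + 1) * tricomiU (a + 2) (2 * s + 2) z))) +
      (-1 / 4 + (s - a) / z + (s - s ^ 2) / z ^ 2) *
        (Complex.exp (-z / 2) * z ^ s * tricomiU a (2 * s) z) =
      Complex.exp (-z / 2) * z ^ s / z *
        (z * (a * (a + 1) * tricomiU (a + 2) (2 * s + 2) z) +
          (2 * s - z) * (-a * tricomiU (a + 1) (2 * s + 1) z) - a * tricomiU a (2 * s) z) := by
    field_simp
    ring
  rw [key, hK, mul_zero]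

/-! ### Whittaker's `W_{κ,μ}` -/

/-- **First derivative of `W_{κ,μ}`** on `Re z > 0` (`Re(½ + μ − κ) > 0`): with `a = ½ + μ − κ`,
`b = 1 + 2μ`, `W′(z) = e^{−z/2} z^{μ+½} ((−½ + (μ+½)/z) U(a,b,z) − a U(a+1,b+1,z))`.
[cite: DLMF, 13.14.3] -/
theorem hasDerivAt_whittakerW (κ μ : ℂ) (ha : 0 < (1 / 2 + μ - κ).re) {z : ℂ} (hz : 0 < z.re) :
    HasDerivAt (whittakerW κ μ)
      (Complex.exp (-z / 2) * z ^ (μ + 1 / 2) *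
        ((-1 / 2 + (μ + 1 / 2) / z) * tricomiU (1 / 2 + μ - κ) (1 + 2 * μ) z +
          -(1 / 2 + μ - κ) * tricomiU (1 / 2 + μ - κ + 1) (1 + 2 * μ + 1) z)) z :=
  hasDerivAt_whittakerFn (1 + 2 * μ) (μ + 1 / 2) ha hz

/-- `deriv` form of the first derivative of `W_{κ,μ}` on `Re z > 0` (`Re(½ + μ − κ) > 0`).
[cite: DLMF, 13.14.3] -/
theorem deriv_whittakerW (κ μ : ℂ) (ha : 0 < (1 / 2 + μ - κ).re) {z : ℂ} (hz : 0 < z.re) :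
    deriv (whittakerW κ μ) z = Complex.exp (-z / 2) * z ^ (μ + 1 / 2) *
        ((-1 / 2 + (μ + 1 / 2) / z) * tricomiU (1 / 2 + μ - κ) (1 + 2 * μ) z +
          -(1 / 2 + μ - κ) * tricomiU (1 / 2 + μ - κ + 1) (1 + 2 * μ + 1) z) :=
  (hasDerivAt_whittakerW κ μ ha hz).deriv

/-- `W_{κ,μ}` is complex-differentiable on `{Re z > 0}` (`Re(½ + μ − κ) > 0`). [cite: DLMF, 13.14.3] -/
theorem differentiableOn_whittakerW (κ μ : ℂ) (ha : 0 < (1 / 2 + μ - κ).re) :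
    DifferentiableOn ℂ (whittakerW κ μ) {z : ℂ | 0 < z.re} := fun _ hz =>
  (hasDerivAt_whittakerW κ μ ha hz).differentiableAt.differentiableWithinAt

/-- `W_{κ,μ}` is analytic on `{Re z > 0}` (`Re(½ + μ − κ) > 0`). [cite: DLMF, 13.14.3] -/
theorem analyticOnNhd_whittakerW (κ μ : ℂ) (ha : 0 < (1 / 2 + μ - κ).re) :
    AnalyticOnNhd ℂ (whittakerW κ μ) {z : ℂ | 0 < z.re} :=
  (differentiableOn_whittakerW κ μ ha).analyticOnNhd
    (isOpen_lt continuous_const Complex.continuous_re)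

/-- **Whittaker's equation, DLMF 13.14.1**, for `W = W_{κ,μ}` on `Re z > 0` (`Re(½ + μ − κ) > 0`):
`W″(z) + (−¼ + κ/z + (¼ − μ²)/z²) W(z) = 0` (Mathlib's `deriv`; from `whittakerFn_ode` with
`s = μ + ½`, `s − a = κ`, `s − s² = ¼ − μ²`). [cite: DLMF, 13.14.1] -/
theorem whittakerW_ode (κ μ : ℂ) (ha : 0 < (1 / 2 + μ - κ).re) {z : ℂ} (hz : 0 < z.re) :
    deriv (deriv (whittakerW κ μ)) z + (-1 / 4 + κ / z + (1 / 4 - μ ^ 2) / z ^ 2) * whittakerW κ μ z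
      = 0 := by
  have h := whittakerFn_ode (a := 1 / 2 + μ - κ) (b := 1 + 2 * μ) (s := μ + 1 / 2) (by ring) ha hz
  rw [show μ + 1 / 2 - (1 / 2 + μ - κ) = κ by ring,
    show μ + 1 / 2 - (μ + 1 / 2) ^ 2 = 1 / 4 - μ ^ 2 by ring] at h
  exact h

/-- **The T1w parameters are admissible**: for real `m`, `δ` the Whittaker parameters `κ = im`,
`μ = ±iδ` of the far face of the extremal Kerr threshold problem
(`whittaker_params_of_extremal_threshold`) have `Re(½ + μ − κ) = ½ > 0`, so `whittakerW (im) (±iδ)`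
and its equation `whittakerW_ode` are available on `Re z > 0`. [folklore] -/
theorem whittaker_params_T1w_admissible (m δ : ℝ) :
    (1 / 2 + (δ : ℂ) * Complex.I - Complex.I * m).re = 1 / 2 ∧
    0 < (1 / 2 + (δ : ℂ) * Complex.I - Complex.I * m).re ∧
    (1 / 2 + -((δ : ℂ) * Complex.I) - Complex.I * m).re = 1 / 2 ∧
    0 < (1 / 2 + -((δ : ℂ) * Complex.I) - Complex.I * m).re := by
  refine ⟨by simp, by simp, by simp, by simp⟩

/-- **Whittaker's equation at the T1w parameters** `κ = im`, `μ = ±iδ` (`m, δ` real): both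
`W_{im, iδ}` and `W_{im, −iδ}` satisfy DLMF 13.14.1 on `Re z > 0` (`whittakerW_ode` with
`whittaker_params_T1w_admissible`). [cite: DLMF, 13.14.1] -/
theorem whittakerW_ode_T1w (m δ : ℝ) {z : ℂ} (hz : 0 < z.re) :
    deriv (deriv (whittakerW (Complex.I * m) (δ * Complex.I))) z +
        (-1 / 4 + Complex.I * m / z + (1 / 4 - ((δ : ℂ) * Complex.I) ^ 2) / z ^ 2) *
          whittakerW (Complex.I * m) (δ * Complex.I) z = 0 ∧
    deriv (deriv (whittakerW (Complex.I * m) (-((δ : ℂ) * Complex.I)))) z +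
        (-1 / 4 + Complex.I * m / z + (1 / 4 - (-((δ : ℂ) * Complex.I)) ^ 2) / z ^ 2) *
          whittakerW (Complex.I * m) (-((δ : ℂ) * Complex.I)) z = 0 :=
  ⟨whittakerW_ode _ _ (whittaker_params_T1w_admissible m δ).2.1 hz,
    whittakerW_ode _ _ (whittaker_params_T1w_admissible m δ).2.2.2 hz⟩

end Literature.Analysis.SpecialFunctions.Confluent

end
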